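import Literature.MathematicalPhysics.QuantumFieldTheory.Balaban1983to89.HiggsCondGauss228
import Literature.MathematicalPhysics.QuantumFieldTheory.Balaban1983to89.B1Eq369GaussRatio
import Literature.MathematicalPhysics.QuantumFieldTheory.Balaban1983to89.HiggsDoubleRT

/-!
# `Balaban1983to89.B1Eq331Model` — T. Bałaban, *(Higgs)₂,₃ quantum fields in a finite volume. I. A lower bound*,
Commun. Math. Phys. **85** (1982) 603–626 [Balaban1982Higgs1]: the Gaussian normalisations **(3.31)** `Z_k`, **(3.32)** `Z_k(A^{(k),ε})`
AT `A^{(k),ε} = 0` (p. 617) and **(1.12)** `exp(E₀)` (p. 606) OF THE CONCRETE (Higgs)₂,₃ MODEL — the Lebesgue integrals over the model's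
configuration spaces of vector fields `A : T*_ε → ℝ` and scalar fields `φ : T_ε → ℝ^N` — IDENTIFIED with p12's matrix Gaussian
`B1GaussNorm339.gaussInt` of p35's coordinate matrices `B1Eq230FluctCov.mat` of the model's operators `(G^ε_k)⁻¹ = −Δ^ε + μ₀² + a_k(L^kε)^{−2}P_k`,
`(G^ε_k(0))⁻¹`, `−Δ^ε + μ₀²`, `−Δ^ε_0 + m²` (p34's integration coordinates `B1Eq221Coordinates.fieldCoord`), with the matrix facts the
determinant calculus of (3.69) needs (symmetry, positive definiteness, `−Δ^ε + μ₀² ≽ μ₀²`, `P_K ⪰ 0`, `Q_KQ_K^* = 1`) PROVED for the model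

statement-level skeleton of published theorems with citation tags; proofs where landed; nothing here is a claim about the Yang–Mills mass gap

PDF held: `paper:balaban1982-cmp85-higgs23-i` (journal page = PDF page + 602); p. 617 [PDF 15] ((3.30)–(3.32)) READ AS IMAGE on the ×2 render
`run/shared/lean/pub/pub-balaban/b2b-balaban-ref1/pages/1982-cmp85-higgs23-I/1982-cmp85-higgs23-I-p015-x2.png`; p. 606 [PDF 4] ((1.12)) and
p. 610 [PDF 8] ((2.20)) on `…-p004-x2.png`, `…-p008-x2.png` and the materialised text `~/.lit/texts/paper-balaban1982-cmp85-higgs23-i/`.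

CITATION HEADER (lean-in-tree rule).  Cell `lit-balaban` (HOME `run/shared/lean/pub/lit-balaban/`), Phase-2 proof seat **p14** gen 11
(unit `lit-balaban-p14`; TAKING line HOME/STATUS.md 2026-08-21T20:41Z), file 1 of 2 of «(3.69) for the concrete model» (file 2:
`B1Eq369Model`).  SKELETON rows **B1.Eq3.30** ((3.31)–(3.32); owner r12, proved at the matrix carriers by p12 `B1GaussNorm331`/`B1GaussNorm339`),
**B1.Eq1.12** ((1.12); decl of record `HiggsLattice.freeNormalization`, owners r01/r14), **B1.Eq3.68–3.69** (consumer, file 2).  NOTHING of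
record is restated: the operators are the typer's `HiggsCovariance.covOpK` / `delta0` ((2.20), (2.17)), the coordinates are p34's `fieldCoord`
(`integral_comp_fieldCoord`, measure preserving) and `HiggsDoubleRT.integral_comp_toSite` (vector fields as `ℝ^d`-valued site functions, p. 608),
the matrices are p35's `B1Eq230FluctCov.mat` (`siteInner_eq_dotProduct`, typer's `HiggsCondGauss228.mat_mulVec_crd`), the matrix Gaussian is p12's
`B1GaussNorm339.gaussInt` (`B1Eq369GaussRatio.gaussInt_pos`), positivity of the forms is the typer's `HiggsCovariancePos.siteInner_covOpK_ge` /
`siteInner_projPk_nonneg` and p35's `B1Eq230FluctCovPos.siteInner_covOpK_comm` / `siteInner_deltaKA_comm` / `siteInner_deltaKA_zero_ge`,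
`Q_kQ_k^* = 1` is p35's `B1Eq27StepAdjoint.avgQkLin_comp_avgQkAdj` — all BY NAME.

WHAT IS PRINTED (verbatim).  p. 617 [PDF 15]: *"The action has the form: S^{(k),L^kε}(A, φ) = −log Z_k − log Z_k(A^{(k),ε}) + ½⟨A, Δ^{(k),L^kε}A⟩
+ ½⟨φ, Δ^{(k),L^kε}(A^{(k),ε})φ⟩ − 𝒫^{(k),L^kε}(A^{(k),ε}, φ) + E₀, (3.30) and for the factors Z_k, Z_k(A^{(k),ε}) we have the formulas:
Z_k = (a_k(L^kε)^{d−2}/2π)^{(d/2)|T₁^{(k)}|} ∫dA exp(−½⟨A, (G^ε_k)⁻¹A⟩), (3.31)  Z_k(A^{(k),ε}) = (a_k(L^kε)^{d−2}/2π)^{(N/2)|T₁^{(k)}|} ∫dφ exp(−½⟨φ,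
(G^ε_k(A^{(k),ε}))⁻¹φ⟩). (3.32)"*; p. 606 [PDF 4]: *"∫dA exp(−½⟨A, (−Δ^ε + μ₀²)A⟩)∫dφ exp(−½⟨φ, (−Δ^ε_0 + m²)φ⟩) = exp(E₀,v)exp(E₀,s) =
exp(E₀). (1.12)"*; p. 610 [PDF 8]: *"G^ε_k(Ω, A) = (−Δ^{ε,N}_{A,Ω} + m² + a_k(L^kε)^{−2}P_k(A))^{−1}, P_k(A) = Q^*_k(A)Q_k(A), (2.20)"*; p. 608: *"The
renormalization transformations for vector fields will be obtained by taking N = d and an external vector field A = 0"*.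

WHAT THIS FILE PROVES (kernel-checked, zero `sorry`; axioms standard; definitions with bodies + theorems).
* §1 the coordinate dictionary for ONE operator `T` on the fields of `T^{(j)}`: `dotProduct_mat_mulVec` (`u·(mat T)v = (L^jε)^{−d}⟨φ, Tψ⟩_{(1.5)}`),
  `isHermitian_mat` (symmetric forms have symmetric matrices), `posSemidef_mat`, `posDef_mat`, `posSemidef_mat_sub_smul` (`⟨φ,Tφ⟩ ≧ μ⟨φ,φ⟩ ⇒
  mat T − μ·1 ⪰ 0`), and **`integral_exp_siteInner_eq_gaussInt`**: `∫dφ exp(−½⟨φ, Tφ⟩) = gaussInt (L^jε) d (mat T)` (p34's change of variables).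
* §2 the model's operators at `A = 0` on `T_ε`: `mat_covOpK` ((2.20): `mat (G^ε_k)⁻¹ = mat(−Δ^ε_0 + m²) + a_k(L^kε)^{−2}·(mat Q^*_k)(mat Q_k)`),
  `mat_Qk_mul_mat_Qks = 1` (`k ≦ K`), `isHermitian_mat_delta0`, **`posDef_mat_delta0`** (`m² > 0`), **`posSemidef_mat_delta0_sub`**
  (`mat(−Δ^ε_{A,Ω} + m²) − m²·1 ⪰ 0`), **`posSemidef_smul_QksQk`** (`a_k(L^kε)^{−2}·(mat Q^*_k)(mat Q_k) ⪰ 0`), `posDef_mat_covOpK`.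
* §3 **the normalisations of the model**: `gaussS C m² a k = ∫dφ exp(−½⟨φ,(G^ε_k(0))⁻¹φ⟩)` over `ScalarField P 0 N`, `gaussV P μ₀² a k = ∫dA
  exp(−½⟨A,(G^ε_k)⁻¹A⟩)` over `VecField P 0` (through `toSite`, p. 608), `gaussS_eq_gaussInt`, `gaussV_eq_gaussS`, `gaussV_eq_gaussInt`, positivity;
  **`zVec`** = (3.31), **`zScal`** = (3.32) at `A^{(k),ε} = 0`, with the printed prefactor `(a_k(L^kε)^{d−2}/2π)^{(d/2)|T^{(k)}|}` resp. `(N/2)|T^{(k)}|`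
  (`B1RT.prec`), `zVec_pos`, `zScal_pos`.
* §4 **(1.12) for the model**: `covDeriv_chargeZero` / `covLaplaceForm_chargeZero` (at `e = 0` the transports are `1`), `vecLaplaceForm_eq_siteInner`
  (`⟨A, −Δ^εA⟩` = the Laplacian form of the `ℝ^d`-valued site function), **`action_free`** (the action (1.11) at `e = λ = 0`, `E = 0`, `m₀² = m²` IS
  `½⟨A, (−Δ^ε + μ₀²)A⟩ + ½⟨φ, (−Δ^ε_0 + m²)φ⟩`), **`partitionFn_free_eq`** (Fubini: the free partition function is the product of the two Gaussian
  integrals), **`exp_freeNormalization`**: `exp(E₀) = gaussInt ε d (mat(−Δ^ε + μ₀²)) · gaussInt ε d (mat(−Δ^ε_0 + m²))` (`m², μ₀² > 0`).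
HONEST SCOPE.  Only `A^{(k),ε} = 0` in (3.32) (what (3.66)–(3.69) use: `Z_K(0)`); the vector field is read through the p. 608 device (`N = d`,
`A = 0`, `toSite`); `m², μ₀² > 0` (p. 605) for positivity; the `|T₁^{(k)}|` of the prefactor is read as the number of sites of `T^{(k)}_{L^kε}`
(`Fintype.card (Site P k)`, p12's two-lattice reading).  Nothing quantitative here ((3.69) is file 2); nothing here is summit progress.
-/

open scoped BigOperators InnerProductSpace Matrix
open _root_.MeasureTheory Matrix

namespace Literature.MathematicalPhysics.QuantumFieldTheory.Balaban1983to89.B1Eq331Model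

open HiggsLattice HiggsCovariance HiggsCovariancePos HiggsCovarianceCont B3MultiscaleFields B1Eq221Coordinates B1Eq230FluctCov
  B1Eq230FluctCovPos HiggsDoubleRT B1GaussNorm339
open HiggsFluctMeasurePos (siteInner_comm siteInner_add_right siteInner_sub_right siteInner_smul_right siteInner_smul_left
  siteInner_self_pos)
open HiggsFluctMeasureCov (siteInner_toSite_toSite)
open HiggsCondGauss228 (mat_mulVec_crd)
open B1Eq27StepAdjoint (avgQkLin_comp_avgQkAdj)
open B1Eq369GaussRatio (gaussInt_pos)
open HiggsFluctMeasure (coeff221 coeff221_eq)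

variable {P : HiggsLattice.Params} {N : ℕ}

/-! ## §1 One operator in p34's integration coordinates: form, symmetry, positivity, Gaussian integral -/

section Dictionary

variable {j : ℕ} (T : HiggsLattice.ScalarField P j N →ₗ[ℝ] HiggsLattice.ScalarField P j N)

/-- `u·(mat T)v = (L^jε)^{−d}·⟨φ, Tψ⟩_{(1.5)}` for `u = fieldCoord φ`, `v = fieldCoord ψ` — the plain coordinate matrix carries the form of
(1.5) up to the uniform weight `(L^jε)^d`. [cite: Balaban1982Higgs1, (1.5) p.604] -/
theorem dotProduct_mat_mulVec (u v : HiggsLattice.Site P j × Ix N → ℝ) :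
    u ⬝ᵥ (mat T *ᵥ v) = (P.mesh j ^ P.d)⁻¹ *
      siteInner ((fieldCoord (E N) (HiggsLattice.Site P j)).symm u) (T ((fieldCoord (E N) (HiggsLattice.Site P j)).symm v)) := by
  have hw : P.mesh j ^ P.d ≠ 0 := (pow_pos (P.mesh_pos j) _).ne'
  rw [siteInner_eq_dotProduct, LinearEquiv.apply_symm_apply, ← mat_mulVec_crd, ← mul_assoc, inv_mul_cancel₀ hw, one_mul]

/-- A `(1.5)`-symmetric operator has a symmetric coordinate matrix. [cite: Balaban1982Higgs1, (1.5) p.604] -/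
theorem isHermitian_mat (hT : ∀ f g, siteInner f (T g) = siteInner g (T f)) : (mat T).IsHermitian := by
  rw [Matrix.IsHermitian, Matrix.conjTranspose_eq_transpose_of_trivial]
  refine Matrix.ext_iff_mulVec.mpr fun v => funext fun i => ?_
  rw [Matrix.mulVec_transpose, ← single_one_dotProduct i (v ᵥ* mat T), dotProduct_comm, ← Matrix.dotProduct_mulVec,
    dotProduct_mat_mulVec, hT, ← dotProduct_mat_mulVec, single_one_dotProduct]

/-- A `(1.5)`-symmetric operator with non-negative form has a positive semidefinite coordinate matrix. [cite: Balaban1982Higgs1, (1.5) p.604] -/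
theorem posSemidef_mat (hT : ∀ f g, siteInner f (T g) = siteInner g (T f)) (h0 : ∀ f, 0 ≤ siteInner f (T f)) :
    (mat T).PosSemidef := by
  refine Matrix.PosSemidef.of_dotProduct_mulVec_nonneg (isHermitian_mat T hT) fun x => ?_
  rw [star_trivial, dotProduct_mat_mulVec]
  exact mul_nonneg (inv_nonneg.2 (pow_nonneg (P.mesh_pos j).le _)) (h0 _)

/-- A `(1.5)`-symmetric operator with positive definite form has a positive definite coordinate matrix. [cite: Balaban1982Higgs1, (1.5) p.604] -/
theorem posDef_mat (hT : ∀ f g, siteInner f (T g) = siteInner g (T f)) (hpos : ∀ f, f ≠ 0 → 0 < siteInner f (T f)) :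
    (mat T).PosDef := by
  refine Matrix.PosDef.of_dotProduct_mulVec_pos (isHermitian_mat T hT) fun x hx => ?_
  rw [star_trivial, dotProduct_mat_mulVec]
  have hφ : (fieldCoord (E N) (HiggsLattice.Site P j)).symm x ≠ 0 := by
    intro h0
    apply hx
    rw [← (fieldCoord (E N) (HiggsLattice.Site P j)).apply_symm_apply x, h0, map_zero]
  exact mul_pos (inv_pos.2 (pow_pos (P.mesh_pos j) _)) (hpos _ hφ)

/-- `⟨φ, Tφ⟩ ≧ μ⟨φ, φ⟩` for a `(1.5)`-symmetric `T` gives `mat T − μ·1 ⪰ 0` (the coordinate form of `⟨φ,φ⟩` is `(L^jε)^d·|fieldCoord φ|²`).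
[cite: Balaban1982Higgs1, (1.5) p.604] -/
theorem posSemidef_mat_sub_smul (hT : ∀ f g, siteInner f (T g) = siteInner g (T f)) {μ : ℝ}
    (hge : ∀ f, μ * siteInner f f ≤ siteInner f (T f)) :
    (mat T - μ • (1 : Matrix (HiggsLattice.Site P j × Ix N) (HiggsLattice.Site P j × Ix N) ℝ)).PosSemidef := by
  have e : mat T - μ • (1 : Matrix (HiggsLattice.Site P j × Ix N) (HiggsLattice.Site P j × Ix N) ℝ) = mat (T - μ • LinearMap.id) := by
    rw [mat_sub, mat_smul, mat_id]
  rw [e]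
  refine posSemidef_mat _ (fun f g => ?_) (fun f => ?_)
  · simp only [LinearMap.sub_apply, LinearMap.smul_apply, LinearMap.id_apply, siteInner_sub_right, siteInner_smul_right]
    rw [hT, siteInner_comm f g]
  · simp only [LinearMap.sub_apply, LinearMap.smul_apply, LinearMap.id_apply, siteInner_sub_right, siteInner_smul_right]
    linarith [hge f]

/-- **The Gaussian integral over the fields IS p12's matrix Gaussian**: `∫dφ exp(−½⟨φ, Tφ⟩_{(1.5)}) = gaussInt (L^jε) d (mat T)`
(`B1GaussNorm339.gaussInt η d M = ∫dv exp(−½η^d vᵀMv)`; p34's measure-preserving coordinates `integral_comp_fieldCoord`). [cite: Balaban1982Higgs1, (3.31)–(3.32) p.617] -/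
theorem integral_exp_siteInner_eq_gaussInt :
    ∫ φ : HiggsLattice.ScalarField P j N, Real.exp (-(1 / 2 : ℝ) * siteInner φ (T φ)) = gaussInt (P.mesh j) P.d (mat T) := by
  rw [integral_comp_fieldCoord (E N) (HiggsLattice.Site P j)]
  unfold gaussInt pairing
  refine integral_congr_ae (Filter.Eventually.of_forall fun v => ?_)
  have hw : P.mesh j ^ P.d ≠ 0 := (pow_pos (P.mesh_pos j) _).ne'
  simp only
  rw [dotProduct_mat_mulVec, ← mul_assoc (P.mesh j ^ P.d), mul_inv_cancel₀ hw, one_mul]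

end Dictionary

/-! ## §2 The model's operators of (2.20)/(2.17) at `A = 0` in coordinates -/

section Operators

variable (C : ChargeData N) (Ω : Finset (HiggsLattice.Site P 0)) (A : HiggsLattice.VecField P 0) (msq a : ℝ)

/-- **(2.20) in coordinates**: `mat (G^ε_k(Ω,A))⁻¹ = mat(−Δ^{ε,N}_{A,Ω} + m²) + a_k(L^kε)^{−2}·(mat Q^*_k(A))(mat Q_k(A))`.
[cite: Balaban1982Higgs1, (2.20) p.610] -/
theorem mat_covOpK (k : ℕ) :
    mat (covOpK C Ω A msq a k) = mat (delta0 C Ω A msq) + coeff221 P a k • (mat (avgQkAdj C A k) * mat (avgQkLin C A k)) := by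
  rw [covOpK_eq_coeff221, mat_add, mat_smul, mat_comp]
  rfl

/-- **`Q_kQ_k^* = 1` in coordinates** (`k ≦ K`; block averaging is onto: p35's `avgQkLin_comp_avgQkAdj`). [cite: Balaban1982Higgs1, (2.11) p.609] -/
theorem mat_Qk_mul_mat_Qks {k : ℕ} (hk : k ≤ P.K) : mat (avgQkLin C A k) * mat (avgQkAdj C A k) = 1 := by
  rw [← mat_comp, avgQkLin_comp_avgQkAdj C A hk, mat_id]

/-- `mat(−Δ^{ε,N}_{A,Ω} + m²)` is symmetric ((2.17) is symmetric for (1.5)). [cite: Balaban1982Higgs1, (2.17) p.610] -/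
theorem isHermitian_mat_delta0 : (mat (delta0 C Ω A msq)).IsHermitian :=
  isHermitian_mat _ fun f g => by
    have h := siteInner_deltaKA_comm C Ω A msq 0 0 f g
    rwa [deltaKA_zero] at h

/-- **`mat(−Δ^{ε,N}_{A,Ω} + m²)` is positive definite** for `m² > 0` (`⟨φ,(−Δ + m²)φ⟩ ≧ m²⟨φ,φ⟩`). [cite: Balaban1982Higgs1, (2.17) p.610] -/
theorem posDef_mat_delta0 (hmsq : 0 < msq) : (mat (delta0 C Ω A msq)).PosDef :=
  posDef_mat _ (fun f g => by
      have h := siteInner_deltaKA_comm C Ω A msq 0 0 f g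
      rwa [deltaKA_zero] at h)
    fun f hf => by
      have h := siteInner_deltaKA_zero_ge C Ω A msq 0 f
      rw [deltaKA_zero] at h
      exact lt_of_lt_of_le (mul_pos hmsq (siteInner_self_pos hf)) h

/-- **`mat(−Δ^{ε,N}_{A,Ω} + m²) − m²·1 ⪰ 0`** — the free operator dominates the mass: `−Δ^{ε,N}_{A,Ω} ⪰ 0` (the input `M₀ ≽ μI` of p12's
`B1Eq369GaussRatio.posSemidef_inv_smul_one_sub_inv`, i.e. `G^ε ≦ μ₀⁻²`, `G^ε(0) ≦ m⁻²`). [cite: Balaban1982Higgs1, (2.17) p.610; (1.12) p.606] -/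
theorem posSemidef_mat_delta0_sub :
    (mat (delta0 C Ω A msq) - msq • (1 : Matrix (HiggsLattice.Site P 0 × Ix N) (HiggsLattice.Site P 0 × Ix N) ℝ)).PosSemidef :=
  posSemidef_mat_sub_smul _ (fun f g => by
      have h := siteInner_deltaKA_comm C Ω A msq 0 0 f g
      rwa [deltaKA_zero] at h)
    fun f => by
      have h := siteInner_deltaKA_zero_ge C Ω A msq 0 f
      rwa [deltaKA_zero] at h

/-- **`c·(mat Q^*_k(A))(mat Q_k(A)) ⪰ 0` for `c ≧ 0`** — `P_k(A) = Q^*_k(A)Q_k(A) ⪰ 0` ((2.20): `⟨φ, P_kφ⟩ = |Q_kφ|²`), in particular for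
`c = a_k(L^kε)^{−2}` (the `R ⪰ 0` of p12's determinant calculus). [cite: Balaban1982Higgs1, (2.20) p.610] -/
theorem posSemidef_smul_QksQk (k : ℕ) {c : ℝ} (hc : 0 ≤ c) : (c • (mat (avgQkAdj C A k) * mat (avgQkLin C A k))).PosSemidef := by
  have e : c • (mat (avgQkAdj C A k) * mat (avgQkLin C A k)) = mat (c • projPk C A k) := by
    rw [mat_smul, projPk, mat_comp]
  rw [e]
  refine posSemidef_mat _ (fun f g => ?_) (fun f => ?_)
  · rw [LinearMap.smul_apply, LinearMap.smul_apply, siteInner_smul_right, siteInner_smul_right, projPk, LinearMap.comp_apply,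
      LinearMap.comp_apply, siteInner_projPk_eq, siteInner_projPk_eq, siteInner_comm]
  · rw [LinearMap.smul_apply, siteInner_smul_right]
    exact mul_nonneg hc (siteInner_projPk_nonneg C A k f)

/-- `mat (G^ε_k(Ω,A))⁻¹` is positive definite (`m² > 0`, `a_k ≧ 0`). [cite: Balaban1982Higgs1, (2.20) p.610] -/
theorem posDef_mat_covOpK (hmsq : 0 < msq) (k : ℕ) (hak : 0 ≤ B1.aSeq a P.L k) : (mat (covOpK C Ω A msq a k)).PosDef :=
  posDef_mat _ (siteInner_covOpK_comm C Ω A msq a k) fun f hf =>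
    lt_of_lt_of_le (mul_pos hmsq (siteInner_self_pos hf)) (siteInner_covOpK_ge C Ω A msq a k hak f)

end Operators

/-! ## §3 The Gaussian normalisations (3.31), (3.32) of the model -/

section Normalisations

variable (C : ChargeData N) (msq a : ℝ)

variable (P) in
/-- **The scalar fluctuation integral of (3.32) at `A^{(k),ε} = 0`**: `∫dφ exp(−½⟨φ, (G^ε_k(0))⁻¹φ⟩)` over the scalar fields of `T_ε`
(Lebesgue measure, p. 605), `(G^ε_k(0))⁻¹ = −Δ^{ε,N}_0 + m² + a_k(L^kε)^{−2}P_k(0)` (`HiggsCovariance.covOpK` at `A = 0`, `Ω = T_ε`).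
[cite: Balaban1982Higgs1, (3.32) p.617; (2.20) p.610] -/
noncomputable def gaussS (C : ChargeData N) (msq a : ℝ) (k : ℕ) : ℝ :=
  ∫ φ : HiggsLattice.ScalarField P 0 N,
    Real.exp (-(1 / 2 : ℝ) * siteInner φ (covOpK C Finset.univ (0 : HiggsLattice.VecField P 0) msq a k φ))

/-- **The vector fluctuation integral of (3.31)**: `∫dA exp(−½⟨A, (G^ε_k)⁻¹A⟩)` over the vector fields `A : T*_ε → ℝ` (Lebesgue measure on the
bond variables, p. 605), `(G^ε_k)⁻¹ = −Δ^ε + μ₀² + a_k(L^kε)^{−2}P_k` read through *"N = d and an external vector field A = 0"* (p. 608: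
`B3MultiscaleFields.toSite`, `zeroCharge`). [cite: Balaban1982Higgs1, (3.31) p.617; p.608] -/
noncomputable def gaussV (P : HiggsLattice.Params) (mu0sq a : ℝ) (k : ℕ) : ℝ :=
  ∫ A : HiggsLattice.VecField P 0,
    Real.exp (-(1 / 2 : ℝ) * siteInner (toSite A)
      (covOpK (zeroCharge P.d) Finset.univ (0 : HiggsLattice.VecField P 0) mu0sq a k (toSite A)))

/-- `∫dφ exp(−½⟨φ, (G^ε_k(0))⁻¹φ⟩) = gaussInt ε d (mat (G^ε_k(0))⁻¹)`. [cite: Balaban1982Higgs1, (3.32) p.617] -/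
theorem gaussS_eq_gaussInt (k : ℕ) :
    gaussS P C msq a k = gaussInt (P.mesh 0) P.d (mat (covOpK C Finset.univ (0 : HiggsLattice.VecField P 0) msq a k)) :=
  integral_exp_siteInner_eq_gaussInt _

/-- The vector integral IS the scalar one at the trivial coupling (`N = d`, `A = 0`; `HiggsDoubleRT.integral_comp_toSite`). [cite: Balaban1982Higgs1, p.608] -/
theorem gaussV_eq_gaussS (mu0sq : ℝ) (k : ℕ) : gaussV P mu0sq a k = gaussS P (zeroCharge P.d) mu0sq a k := by
  unfold gaussV gaussS
  exact integral_comp_toSite (fun f : HiggsLattice.ScalarField P 0 P.d =>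
    Real.exp (-(1 / 2 : ℝ) * siteInner f (covOpK (zeroCharge P.d) Finset.univ (0 : HiggsLattice.VecField P 0) mu0sq a k f)))

/-- `∫dA exp(−½⟨A, (G^ε_k)⁻¹A⟩) = gaussInt ε d (mat (G^ε_k)⁻¹)`. [cite: Balaban1982Higgs1, (3.31) p.617] -/
theorem gaussV_eq_gaussInt (mu0sq : ℝ) (k : ℕ) :
    gaussV P mu0sq a k = gaussInt (P.mesh 0) P.d (mat (covOpK (zeroCharge P.d) Finset.univ (0 : HiggsLattice.VecField P 0) mu0sq a k)) := by
  rw [gaussV_eq_gaussS, gaussS_eq_gaussInt]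

/-- `∫dφ exp(−½⟨φ, (G^ε_k(0))⁻¹φ⟩) > 0` (`m² > 0`, `a_k ≧ 0`: a genuine Gaussian integral). [cite: Balaban1982Higgs1, (3.32) p.617] -/
theorem gaussS_pos {msq : ℝ} (hmsq : 0 < msq) (k : ℕ) (hak : 0 ≤ B1.aSeq a P.L k) : 0 < gaussS P C msq a k := by
  rw [gaussS_eq_gaussInt]
  exact gaussInt_pos (P.mesh_pos 0) P.d (posDef_mat_covOpK C Finset.univ 0 msq a hmsq k hak)

/-- `∫dA exp(−½⟨A, (G^ε_k)⁻¹A⟩) > 0` (`μ₀² > 0`, `a_k ≧ 0`). [cite: Balaban1982Higgs1, (3.31) p.617] -/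
theorem gaussV_pos {mu0sq : ℝ} (hmu : 0 < mu0sq) (k : ℕ) (hak : 0 ≤ B1.aSeq a P.L k) : 0 < gaussV P mu0sq a k := by
  rw [gaussV_eq_gaussS]
  exact gaussS_pos (zeroCharge P.d) a hmu k hak

/-- **(3.31) `Z_k` OF THE MODEL**: `Z_k = (a_k(L^kε)^{d−2}/2π)^{(d/2)|T^{(k)}|}·∫dA exp(−½⟨A, (G^ε_k)⁻¹A⟩)` (`a_k(L^kε)^{d−2}` = `B1RT.prec`, `|T^{(k)}|`
= the number of sites of `T^{(k)}_{L^kε}`). [cite: Balaban1982Higgs1, (3.31) p.617] -/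
noncomputable def zVec (P : HiggsLattice.Params) (mu0sq a : ℝ) (k : ℕ) : ℝ :=
  (B1RT.prec (B1.aSeq a P.L k) (P.mesh k) P.d / (2 * Real.pi)) ^ ((P.d : ℝ) / 2 * (Fintype.card (HiggsLattice.Site P k) : ℝ))
    * gaussV P mu0sq a k

variable (P) in
/-- **(3.32) `Z_k(A^{(k),ε})` OF THE MODEL AT `A^{(k),ε} = 0`**: `Z_k(0) = (a_k(L^kε)^{d−2}/2π)^{(N/2)|T^{(k)}|}·∫dφ exp(−½⟨φ, (G^ε_k(0))⁻¹φ⟩)`.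
[cite: Balaban1982Higgs1, (3.32) p.617] -/
noncomputable def zScal (C : ChargeData N) (msq a : ℝ) (k : ℕ) : ℝ :=
  (B1RT.prec (B1.aSeq a P.L k) (P.mesh k) P.d / (2 * Real.pi)) ^ ((N : ℝ) / 2 * (Fintype.card (HiggsLattice.Site P k) : ℝ))
    * gaussS P C msq a k

/-- `Z_k > 0` (`k ≧ 1`, `a > 0`, `L > 1`, `μ₀² > 0`). [cite: Balaban1982Higgs1, (3.31) p.617] -/
theorem zVec_pos {mu0sq a : ℝ} (hmu : 0 < mu0sq) (ha : 0 < a) (hL : 1 < (P.L : ℝ)) {k : ℕ} (hk : 1 ≤ k) : 0 < zVec P mu0sq a k := by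
  have hak := B1.aSeq_pos ha hL hk
  exact mul_pos (Real.rpow_pos_of_pos (div_pos (B1RT.prec_pos hak (P.mesh_pos k) P.d) (by positivity)) _) (gaussV_pos a hmu k hak.le)

/-- `Z_k(0) > 0` (`k ≧ 1`, `a > 0`, `L > 1`, `m² > 0`). [cite: Balaban1982Higgs1, (3.32) p.617] -/
theorem zScal_pos {msq a : ℝ} (hmsq : 0 < msq) (ha : 0 < a) (hL : 1 < (P.L : ℝ)) {k : ℕ} (hk : 1 ≤ k) :
    0 < zScal P C msq a k := by
  have hak := B1.aSeq_pos ha hL hk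
  exact mul_pos (Real.rpow_pos_of_pos (div_pos (B1RT.prec_pos hak (P.mesh_pos k) P.d) (by positivity)) _) (gaussS_pos C a hmsq k hak.le)

end Normalisations

/-! ## §4 (1.12) for the model: the free normalisation is the product of two matrix Gaussians -/

section Free

variable (C : ChargeData N)

/-- At zero charge the transports are the identity: `U(A) = exp(q·ε·0·A) = 1` (p. 605). [cite: Balaban1982Higgs1, (1.7) p.605] -/
theorem U_chargeZero (η x : ℝ) : ({ C with e := 0 } : ChargeData N).U η x = 1 := by
  unfold ChargeData.U
  have h0 : (η * ({ C with e := 0 } : ChargeData N).e * x) • ({ C with e := 0 } : ChargeData N).q = 0 := by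
    have he : ({ C with e := 0 } : ChargeData N).e = 0 := rfl
    rw [he, mul_zero, zero_mul]
    exact zero_smul ℝ ({ C with e := 0 } : ChargeData N).q
  rw [h0, NormedSpace.exp_zero]

/-- At zero charge the covariant derivative (1.7) is the difference derivative (1.4), whatever the vector field. [cite: Balaban1982Higgs1, (1.7) p.605] -/
theorem covDeriv_chargeZero {k : ℕ} (A : HiggsLattice.VecField P k) (φ : HiggsLattice.ScalarField P k N) (b : HiggsLattice.PBond P k) :
    covDeriv ({ C with e := 0 } : ChargeData N) A φ b = sderiv φ b := by
  unfold covDeriv sderiv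
  rw [U_chargeZero]
  rfl

/-- At zero charge `⟨φ, −Δ^ε_Aφ⟩ = ⟨φ, −Δ^ε_0φ⟩` = the form of the typer's `covLaplacianN C T_ε 0` ((1.11) at `e = 0`, as in (1.12)).
[cite: Balaban1982Higgs1, (1.12) p.606; (1.11) p.605] -/
theorem covLaplaceForm_chargeZero {k : ℕ} (A : HiggsLattice.VecField P k) (φ : HiggsLattice.ScalarField P k N) :
    covLaplaceForm ({ C with e := 0 } : ChargeData N) A φ = siteInner φ (covLaplacianN C Finset.univ (0 : HiggsLattice.VecField P k) φ) := by
  rw [siteInner_covLaplacianN_univ_self]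
  unfold covLaplaceForm
  exact Finset.sum_congr rfl fun b _ => by rw [covDeriv_chargeZero, covDeriv_zero]

/-- The difference derivative of the `ℝ^d`-valued site function of a vector field, componentwise: `(∂(A_μ)_μ)(b) = ((∂A_μ)(b))_μ`.
[cite: Balaban1982Higgs1, (1.4) p.604; p.608] -/
theorem sderiv_toSite {k : ℕ} (A : HiggsLattice.VecField P k) (b : HiggsLattice.PBond P k) :
    sderiv (toSite A) b = WithLp.toLp 2 (fun μ : Fin P.d => sderiv (A.comp μ) b) := by
  ext μ
  simp [sderiv, toSite, HiggsLattice.VecField.comp, smul_eq_mul]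

/-- **`⟨A, −Δ^εA⟩` (Feynman gauge, componentwise) IS the Laplacian form of the `ℝ^d`-valued site function `x ↦ (A_μ(x))_μ`** (p. 608: *"N = d and an
external vector field A = 0"*): `vecLaplaceForm A = ⟨toSite A, (−Δ^ε) toSite A⟩`. [cite: Balaban1982Higgs1, (1.11) p.605; p.608] -/
theorem vecLaplaceForm_eq_siteInner {k : ℕ} (A : HiggsLattice.VecField P k) :
    vecLaplaceForm A = siteInner (toSite A) (covLaplacianN (zeroCharge P.d) Finset.univ (0 : HiggsLattice.VecField P k) (toSite A)) := by
  rw [siteInner_covLaplacianN_univ_self]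
  unfold vecLaplaceForm covLaplaceForm
  rw [Finset.sum_comm]
  refine Finset.sum_congr rfl fun b _ => ?_
  rw [covDeriv_zero, sderiv_toSite, EuclideanSpace.norm_sq_eq, Finset.mul_sum]
  refine Finset.sum_congr rfl fun μ _ => ?_
  simp [Real.norm_eq_abs, sq_abs]

/-- **The action (1.11) at the free point of (1.12)** (`e = λ = 0`, `E = 0`, `m₀² = m²`): `S^ε(A, φ) = ½⟨A, (−Δ^ε + μ₀²)A⟩ + ½⟨φ, (−Δ^ε_0 + m²)φ⟩`
with the operators `HiggsCovariance.delta0` (2.17) of the vector field (through `toSite`, `N = d`) and of the scalar field at `A = 0`.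
[cite: Balaban1982Higgs1, (1.12) p.606; (1.11) p.605; (2.17) p.610] -/
theorem action_free (msq mu0sq : ℝ) (A : HiggsLattice.VecField P 0) (φ : HiggsLattice.ScalarField P 0 N) :
    action ({ C with e := 0 } : ChargeData N) ⟨msq, 0, mu0sq, 0⟩ A φ
      = (1 / 2 : ℝ) * siteInner (toSite A) (delta0 (zeroCharge P.d) Finset.univ (0 : HiggsLattice.VecField P 0) mu0sq (toSite A))
        + (1 / 2 : ℝ) * siteInner φ (delta0 C Finset.univ (0 : HiggsLattice.VecField P 0) msq φ) := by
  have hpot : potential (⟨msq, 0, mu0sq, 0⟩ : Couplings) φ = msq / 2 * siteInner φ φ := by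
    unfold potential
    rw [siteInner_self_eq, Finset.mul_sum]
    exact Finset.sum_congr rfl fun x _ => by ring
  have hmass : ∑ b : HiggsLattice.PBond P 0, P.mesh 0 ^ P.d * (mu0sq * A b ^ 2) = mu0sq * siteInner (toSite A) (toSite A) := by
    rw [siteInner_toSite_toSite, Finset.mul_sum, Finset.mul_sum]
    exact Finset.sum_congr rfl fun b _ => by ring
  unfold action
  simp only [delta0, LinearMap.add_apply, LinearMap.smul_apply, LinearMap.id_apply, siteInner_add_right, siteInner_smul_right]
  rw [covLaplaceForm_chargeZero, vecLaplaceForm_eq_siteInner, hpot, hmass]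
  ring

/-- **The free partition function is the product of the two Gaussian integrals** (Fubini on `dA dφ`, p. 605):
`∫dA∫dφ exp(−S^ε|_{e=λ=E=0, m₀²=m²}) = ∫dA exp(−½⟨A,(−Δ^ε+μ₀²)A⟩) · ∫dφ exp(−½⟨φ,(−Δ^ε_0+m²)φ⟩)`. [cite: Balaban1982Higgs1, (1.12) p.606] -/
theorem partitionFn_free_eq (msq mu0sq : ℝ) :
    partitionFn P 0 N ({ C with e := 0 } : ChargeData N) ⟨msq, 0, mu0sq, 0⟩
      = (∫ A : HiggsLattice.VecField P 0, Real.exp (-(1 / 2 : ℝ) *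
            siteInner (toSite A) (delta0 (zeroCharge P.d) Finset.univ (0 : HiggsLattice.VecField P 0) mu0sq (toSite A))))
        * ∫ φ : HiggsLattice.ScalarField P 0 N, Real.exp (-(1 / 2 : ℝ) *
            siteInner φ (delta0 C Finset.univ (0 : HiggsLattice.VecField P 0) msq φ)) := by
  unfold partitionFn
  rw [← integral_prod_mul]
  refine integral_congr_ae (Filter.Eventually.of_forall fun Φ => ?_)
  simp only
  rw [action_free, ← Real.exp_add]
  ring_nf

/-- `(G^ε_0)⁻¹ = −Δ^ε + m²` at level `0`: the `P_0`-term of (2.20) carries the coefficient `a_0 = 0` (the tree's `B1.aSeq a L 0 = 0`), so the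
level-`0` Gaussian integrals are the FREE ones of (1.12). [cite: Balaban1982Higgs1, (2.20) p.610; (1.12) p.606] -/
theorem covOpK_zero_eq_delta0 (Ω : Finset (HiggsLattice.Site P 0)) (A : HiggsLattice.VecField P 0) (msq a : ℝ) :
    covOpK C Ω A msq a 0 = delta0 C Ω A msq := by
  have h0 : B1.aSeq a P.L 0 = 0 := by rw [B1.aSeq_eq]; simp
  rw [covOpK_eq_coeff221, HiggsFluctMeasure.coeff221_eq, h0, zero_mul, zero_smul, add_zero]
  rfl

/-- **(1.12) FOR THE MODEL**: `exp(E₀) = ∫dA exp(−½⟨A,(−Δ^ε+μ₀²)A⟩)·∫dφ exp(−½⟨φ,(−Δ^ε_0+m²)φ⟩) = gaussInt ε d (mat(−Δ^ε+μ₀²)) · gaussInt ε d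
(mat(−Δ^ε_0+m²))` (`HiggsLattice.freeNormalization` is `log` of the left side; `m², μ₀² > 0` make it a genuine logarithm). [cite: Balaban1982Higgs1, (1.12) p.606] -/
theorem exp_freeNormalization {msq mu0sq : ℝ} (hmsq : 0 < msq) (hmu : 0 < mu0sq) (a : ℝ) :
    Real.exp (freeNormalization P 0 N C msq mu0sq) = gaussV P mu0sq a 0 * gaussS P C msq a 0 := by
  have hV : gaussV P mu0sq a 0 = ∫ A : HiggsLattice.VecField P 0, Real.exp (-(1 / 2 : ℝ) *
      siteInner (toSite A) (delta0 (zeroCharge P.d) Finset.univ (0 : HiggsLattice.VecField P 0) mu0sq (toSite A))) := by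
    unfold gaussV
    simp_rw [covOpK_zero_eq_delta0]
  have hS : gaussS P C msq a 0 = ∫ φ : HiggsLattice.ScalarField P 0 N, Real.exp (-(1 / 2 : ℝ) *
      siteInner φ (delta0 C Finset.univ (0 : HiggsLattice.VecField P 0) msq φ)) := by
    unfold gaussS
    simp_rw [covOpK_zero_eq_delta0]
  have h0 : (0 : ℝ) ≤ B1.aSeq a P.L 0 := by rw [B1.aSeq_eq]; simp
  have hpos : 0 < gaussV P mu0sq a 0 * gaussS P C msq a 0 :=
    mul_pos (gaussV_pos a hmu 0 h0) (gaussS_pos C a hmsq 0 h0)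
  unfold freeNormalization
  rw [partitionFn_free_eq, ← hV, ← hS, Real.exp_log hpos]

/-- (1.12) in p12's letters: `exp(E₀) = gaussInt ε d (mat(−Δ^ε + μ₀²)) · gaussInt ε d (mat(−Δ^ε_0 + m²))` (the `E₀ = E₀,v + E₀,s` of
`B1Eq369GaussRatio.E0` at the model's matrices). [cite: Balaban1982Higgs1, (1.12) p.606] -/
theorem exp_freeNormalization_eq_gaussInt {msq mu0sq : ℝ} (hmsq : 0 < msq) (hmu : 0 < mu0sq) :
    Real.exp (freeNormalization P 0 N C msq mu0sq)
      = gaussInt (P.mesh 0) P.d (mat (delta0 (zeroCharge P.d) Finset.univ (0 : HiggsLattice.VecField P 0) mu0sq))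
        * gaussInt (P.mesh 0) P.d (mat (delta0 C Finset.univ (0 : HiggsLattice.VecField P 0) msq)) := by
  rw [exp_freeNormalization C hmsq hmu 0, gaussV_eq_gaussInt, gaussS_eq_gaussInt, covOpK_zero_eq_delta0, covOpK_zero_eq_delta0]

end Free

end Literature.MathematicalPhysics.QuantumFieldTheory.Balaban1983to89.B1Eq331Model
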